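import Summits.ValiantsHypothesis.ValiantsHypothesis.Theorems.LacunarySymmetroidMatrixDescartesPivotValley
import Summits.ValiantsHypothesis.ValiantsHypothesis.Theorems.LacunarySymmetroidMatrixDescartesPivotMonotoneWindow

/-!
# `MatrixDescartes` (stmt-ValiantsHypothesis-18050) — the PIVOT-VALLEY LAW AT INDEX ONE, every size `m`:
# `Z₊ ≤ 2 + #{roots in the valley}` (one root per flank instead of `m`)

HONEST FRAMING.  Cell `pub-symmetroid`, seat `val-sym-mdr-p1` (gen 10); helper `--supports` the crux
`Theses.LacunarySymmetroid.MatrixDescartes` (OPEN, on HOLD), NO closure claim.  General pencil format of the census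
(`F = ∑ₗ X^{dₗ} • Sₗ`, real symmetric `m × m` letters, a PIVOT index `π` whose letter `S_π` is the free one).

The PIVOT-VALLEY LAW (val-sym-mdr-p2 g5, `…PivotValley.pivotValley_posRoots_le`): with every letter off the pivot exponent
PSD and cross-pivot dominance certificates at two scales `0 < x₁ ≤ x₂`, `u ↦ F(u)/u^{d_π}` is Loewner non-increasing on
`(0, x₁]` and non-decreasing on `[x₂, ∞)` (`flank_anti_left` / `flank_mono_right`), so each flank carries at most `m` roots and
`Z₊ ≤ 2m` when the valley `[x₁, x₂)` is root-free.  THIS FILE: if the pivot letter has NEGATIVE INDEX ONE (`S_π + W Wᵀ ⪰ 0`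
for one column `W`, `det S_π ≠ 0`) and every other LETTER is PSD, then EVERY positive root is a PSD point of `F`
(tree, val-sym-mdr-p1 g7: `IndexOneRoots.posSemidef_of_det_eq_zero`), and on a Loewner-monotone window two PSD roots would force a
common kernel vector on the interval between them, i.e. `det F ≡ 0` (same mechanism and scalar tools as the companion
`…PivotMonotoneWindow`, which treats the pivot format `X^e • J + ∑ X^{dₖ} • Pₖ`; here the census's general format); hence

* `card_roots_window_le_one_anti` / `…_mono` — ≤ 1 root on any order-connected window `𝒲 ⊆ (0, ∞)` on which the roots are PSD
  points and `F(u)/u^{d_π}` is Loewner non-increasing (resp. non-decreasing), in the toolkit's normalisation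
  `((s^{d_π})⁻¹ • F(s) − (t^{d_π})⁻¹ • F(t)) ⪰ 0`;
* `posSemidef_at_posRoot_general` — index one ⇒ every positive root of `det F` is a PSD point of `F(u)` (general format);
* **`pivotValley_posRoots_le_two_add_of_indexOne`** — under the two dominance certificates of the valley law,
  `Z₊ ≤ 2 + #{roots u with x₁ ≤ u < x₂}`;  **`pivotValley_posRoots_le_two_of_indexOne`** — if the valley is root-free, `Z₊ ≤ 2`
  (for every size `m`; the valley law gives `2m`).

For the `m = 2` programme this says: the conjectured row `(2,K) ≤ 2K` would FOLLOW from «a certified valley carries at most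
`2K − 2` roots», but that stronger statement is FALSE — on the cell's `K = 4` eight-root witness (val-sym-mdr-p1 g5) the canonical
valley (where the Euler derivative `∑ₖ (dₖ−e) u^{dₖ} Pₖ` is indefinite) contains all `8 = 2K` roots and both flanks are empty; the flank
bound is what it is, an a-priori localisation of all but at most two roots.  Nothing here bears on `MatrixDescartes` in its window,
`DoorA26`/`DoorA34`, the registers, or `VP ≠ VNP`.

[folklore] Loewner order; kernel of a PSD matrix from an isotropic vector (Mathlib `Matrix.PosSemidef.dotProduct_mulVec_zero_iff`);
`Polynomial.eq_zero_of_infinite_isRoot`; tree lemmas named above; no single source.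
-/

-- `Summit.ValiantsHypothesis.ValiantsHypothesis.…` repeats a component by the D-0017 layout
-- (single-conjunct summit), which the `dupNamespace` linter flags; the name is mandated.
set_option linter.dupNamespace false

namespace Summit.ValiantsHypothesis.ValiantsHypothesis.Theorems.LacunarySymmetroidMatrixDescartes.PivotValleyIndexOne

open Polynomial Matrix Finset
open scoped BigOperators

variable {m K : ℕ}

/-! ### 1. Tools (general format `∑ₗ u^{dₗ} • Sₗ`) -/

/-- The evaluated pencil is a symmetric (Hermitian) real matrix. [folklore] -/
theorem isHermitian_eval (d : Fin K → ℕ) (S : Fin K → Matrix (Fin m) (Fin m) ℝ) (hS : ∀ l, (S l).IsSymm) (u : ℝ) :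
    (∑ l, (u ^ d l) • S l).IsHermitian := by
  have h := LoewnerSector.smul_family_isSymm d S hS 1 u
  rw [one_smul] at h
  exact Matrix.isHermitian_iff_isSymm.2 h

/-- If `det F(u) = 0` at every point of a non-trivial interval, `det F` is the zero polynomial. [folklore] -/
theorem det_pencil_eq_zero_of_det_eval_eq_zero_on_Icc (d : Fin K → ℕ) (S : Fin K → Matrix (Fin m) (Fin m) ℝ)
    {a b : ℝ} (hab : a < b) (h : ∀ u, a ≤ u → u ≤ b → (∑ l, (u ^ d l) • S l).det = 0) :
    Matrix.det (∑ l, ((X : ℝ[X]) ^ d l) • (S l).map Polynomial.C) = 0 := by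
  refine Polynomial.eq_zero_of_infinite_isRoot _ ((Set.Icc_infinite hab).mono fun u hu => ?_)
  change Polynomial.IsRoot _ u
  rw [Polynomial.IsRoot.def, ChainSector.eval_det_pencil]
  exact h u hu.1 hu.2

/-! ### 2. One root per monotone window when the roots are PSD points -/

/-- **Non-increasing window.**  If on an order-connected window `𝒲 ⊆ (0, ∞)` every root of `det F` is a PSD point of
`F(u) = ∑ u^{dₗ} Sₗ` and `u ↦ F(u)/u^{d_π}` is Loewner non-increasing (toolkit normalisation), then `det F` has at most one
root in `𝒲`. [folklore] -/
theorem card_roots_window_le_one_anti (d : Fin K → ℕ) (S : Fin K → Matrix (Fin m) (Fin m) ℝ)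
    (hS : ∀ l, (S l).IsSymm) (π : Fin K) (𝒲 : Set ℝ) [DecidablePred (· ∈ 𝒲)] (h𝒲 : 𝒲.OrdConnected)
    (hpos : ∀ u ∈ 𝒲, 0 < u)
    (hpsd : ∀ u ∈ 𝒲, u ∈ (Matrix.det (∑ l, ((X : ℝ[X]) ^ d l) • (S l).map Polynomial.C)).roots →
      (∑ l, (u ^ d l) • S l).PosSemidef)
    (hanti : ∀ s ∈ 𝒲, ∀ t ∈ 𝒲, s ≤ t →
      (((s ^ d π)⁻¹ • ∑ l, (s ^ d l) • S l) - ((t ^ d π)⁻¹ • ∑ l, (t ^ d l) • S l)).PosSemidef) :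
    ((Matrix.det (∑ l, ((X : ℝ[X]) ^ d l) • (S l).map Polynomial.C)).roots.toFinset.filter
        (fun u => u ∈ 𝒲)).card ≤ 1 := by
  classical
  set p := Matrix.det (∑ l, ((X : ℝ[X]) ^ d l) • (S l).map Polynomial.C) with hp
  by_cases hp0 : p = 0
  · rw [hp0, Polynomial.roots_zero]; simp
  refine Finset.card_le_one.mpr fun a ha b hb => ?_
  simp only [Finset.mem_filter, Multiset.mem_toFinset] at ha hb
  have key : ∀ a' ∈ 𝒲, ∀ b' ∈ 𝒲, a' < b' → a' ∈ p.roots → b' ∈ p.roots → False := by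
    intro a' ha' b' hb' hab hra hrb
    have ha'0 : 0 < a' := hpos a' ha'
    have hFb := hpsd b' hb' hrb
    have hdeta : (∑ l, (a' ^ d l) • S l).det = 0 := by
      have h := (Polynomial.mem_roots hp0).1 hra
      rwa [Polynomial.IsRoot.def, hp, ChainSector.eval_det_pencil] at h
    obtain ⟨v, hv0, hva⟩ := Matrix.exists_mulVec_eq_zero_iff.mpr hdeta
    refine hp0 (det_pencil_eq_zero_of_det_eval_eq_zero_on_Icc d S hab fun u hau hub => ?_)
    have hu𝒲 : u ∈ 𝒲 := h𝒲.out ha' hb' ⟨hau, hub⟩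
    have hu0 : 0 < u := hpos u hu𝒲
    have hue : 0 < (u ^ d π)⁻¹ := inv_pos.2 (pow_pos hu0 _)
    have hbe : 0 < (b' ^ d π)⁻¹ := inv_pos.2 (pow_pos (ha'0.trans hab) _)
    have hae : 0 < (a' ^ d π)⁻¹ := inv_pos.2 (pow_pos ha'0 _)
    -- `F(u)` is PSD: `u^{-e} F(u) ⪰ b'^{-e} F(b') ⪰ 0`
    have h2 := hanti u hu𝒲 b' hb' hub
    have hFu : (∑ l, (u ^ d l) • S l).PosSemidef := by
      refine Matrix.PosSemidef.of_dotProduct_mulVec_nonneg (isHermitian_eval d S hS u) fun w => ?_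
      rw [star_trivial]
      have hw := Pivot.MonotoneWindow.quadForm_le_of_posSemidef_smul_sub_smul h2 w
      have hwb : 0 ≤ w ⬝ᵥ ((∑ l, (b' ^ d l) • S l) *ᵥ w) := by
        simpa using hFb.dotProduct_mulVec_nonneg w
      nlinarith [mul_nonneg hbe.le hwb]
    -- the kernel vector of `F(a')` is isotropic for `F(u)`: `a'^{-e} F(a') ⪰ u^{-e} F(u)`
    have h1 := hanti a' ha' u hu𝒲 hau
    have hq_le : v ⬝ᵥ ((∑ l, (u ^ d l) • S l) *ᵥ v) ≤ 0 := by
      have hv := Pivot.MonotoneWindow.quadForm_le_of_posSemidef_smul_sub_smul h1 v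
      rw [hva, dotProduct_zero, mul_zero] at hv
      nlinarith
    have hq_ge : 0 ≤ v ⬝ᵥ ((∑ l, (u ^ d l) • S l) *ᵥ v) := by
      simpa using hFu.dotProduct_mulVec_nonneg v
    have hq : v ⬝ᵥ ((∑ l, (u ^ d l) • S l) *ᵥ v) = 0 := le_antisymm hq_le hq_ge
    have hker : (∑ l, (u ^ d l) • S l) *ᵥ v = 0 := by
      have hiff := hFu.dotProduct_mulVec_zero_iff v
      rw [star_trivial] at hiff
      exact hiff.1 hq
    exact Matrix.exists_mulVec_eq_zero_iff.mp ⟨v, hv0, hker⟩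
  rcases lt_trichotomy a b with hlt | heq | hgt
  · exact (key a ha.2 b hb.2 hlt ha.1 hb.1).elim
  · exact heq
  · exact (key b hb.2 a ha.2 hgt hb.1 ha.1).elim

/-- **Non-decreasing window** (`((t^{d_π})⁻¹ • F(t) − (s^{d_π})⁻¹ • F(s)) ⪰ 0` for `s ≤ t` in `𝒲`): at most one root,
the kernel vector being taken at the right root. [folklore] -/
theorem card_roots_window_le_one_mono (d : Fin K → ℕ) (S : Fin K → Matrix (Fin m) (Fin m) ℝ)
    (hS : ∀ l, (S l).IsSymm) (π : Fin K) (𝒲 : Set ℝ) [DecidablePred (· ∈ 𝒲)] (h𝒲 : 𝒲.OrdConnected)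
    (hpos : ∀ u ∈ 𝒲, 0 < u)
    (hpsd : ∀ u ∈ 𝒲, u ∈ (Matrix.det (∑ l, ((X : ℝ[X]) ^ d l) • (S l).map Polynomial.C)).roots →
      (∑ l, (u ^ d l) • S l).PosSemidef)
    (hmono : ∀ s ∈ 𝒲, ∀ t ∈ 𝒲, s ≤ t →
      (((t ^ d π)⁻¹ • ∑ l, (t ^ d l) • S l) - ((s ^ d π)⁻¹ • ∑ l, (s ^ d l) • S l)).PosSemidef) :
    ((Matrix.det (∑ l, ((X : ℝ[X]) ^ d l) • (S l).map Polynomial.C)).roots.toFinset.filter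
        (fun u => u ∈ 𝒲)).card ≤ 1 := by
  classical
  set p := Matrix.det (∑ l, ((X : ℝ[X]) ^ d l) • (S l).map Polynomial.C) with hp
  by_cases hp0 : p = 0
  · rw [hp0, Polynomial.roots_zero]; simp
  refine Finset.card_le_one.mpr fun a ha b hb => ?_
  simp only [Finset.mem_filter, Multiset.mem_toFinset] at ha hb
  have key : ∀ a' ∈ 𝒲, ∀ b' ∈ 𝒲, a' < b' → a' ∈ p.roots → b' ∈ p.roots → False := by
    intro a' ha' b' hb' hab hra hrb
    have ha'0 : 0 < a' := hpos a' ha'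
    have hb'0 : 0 < b' := ha'0.trans hab
    have hFa := hpsd a' ha' hra
    have hdetb : (∑ l, (b' ^ d l) • S l).det = 0 := by
      have h := (Polynomial.mem_roots hp0).1 hrb
      rwa [Polynomial.IsRoot.def, hp, ChainSector.eval_det_pencil] at h
    obtain ⟨v, hv0, hvb⟩ := Matrix.exists_mulVec_eq_zero_iff.mpr hdetb
    refine hp0 (det_pencil_eq_zero_of_det_eval_eq_zero_on_Icc d S hab fun u hau hub => ?_)
    have hu𝒲 : u ∈ 𝒲 := h𝒲.out ha' hb' ⟨hau, hub⟩
    have hu0 : 0 < u := hpos u hu𝒲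
    have hue : 0 < (u ^ d π)⁻¹ := inv_pos.2 (pow_pos hu0 _)
    have hae : 0 < (a' ^ d π)⁻¹ := inv_pos.2 (pow_pos ha'0 _)
    have hbe : 0 < (b' ^ d π)⁻¹ := inv_pos.2 (pow_pos hb'0 _)
    -- `F(u)` is PSD: `u^{-e} F(u) ⪰ a'^{-e} F(a') ⪰ 0`
    have h1 := hmono a' ha' u hu𝒲 hau
    have hFu : (∑ l, (u ^ d l) • S l).PosSemidef := by
      refine Matrix.PosSemidef.of_dotProduct_mulVec_nonneg (isHermitian_eval d S hS u) fun w => ?_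
      rw [star_trivial]
      have hw := Pivot.MonotoneWindow.quadForm_le_of_posSemidef_smul_sub_smul h1 w
      have hwa : 0 ≤ w ⬝ᵥ ((∑ l, (a' ^ d l) • S l) *ᵥ w) := by
        simpa using hFa.dotProduct_mulVec_nonneg w
      nlinarith [mul_nonneg hae.le hwa]
    -- the kernel vector of `F(b')` is isotropic for `F(u)`: `b'^{-e} F(b') ⪰ u^{-e} F(u)`
    have h2 := hmono u hu𝒲 b' hb' hub
    have hq_le : v ⬝ᵥ ((∑ l, (u ^ d l) • S l) *ᵥ v) ≤ 0 := by
      have hv := Pivot.MonotoneWindow.quadForm_le_of_posSemidef_smul_sub_smul h2 v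
      rw [hvb, dotProduct_zero, mul_zero] at hv
      nlinarith
    have hq_ge : 0 ≤ v ⬝ᵥ ((∑ l, (u ^ d l) • S l) *ᵥ v) := by
      simpa using hFu.dotProduct_mulVec_nonneg v
    have hq : v ⬝ᵥ ((∑ l, (u ^ d l) • S l) *ᵥ v) = 0 := le_antisymm hq_le hq_ge
    have hker : (∑ l, (u ^ d l) • S l) *ᵥ v = 0 := by
      have hiff := hFu.dotProduct_mulVec_zero_iff v
      rw [star_trivial] at hiff
      exact hiff.1 hq
    exact Matrix.exists_mulVec_eq_zero_iff.mp ⟨v, hv0, hker⟩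
  rcases lt_trichotomy a b with hlt | heq | hgt
  · exact (key a ha.2 b hb.2 hlt ha.1 hb.1).elim
  · exact heq
  · exact (key b hb.2 a ha.2 hgt hb.1 ha.1).elim

/-! ### 3. Index one: every positive root is a PSD point (general format) -/

/-- **Index one ⇒ PSD roots (general format).**  If the pivot letter `S_π` has `det S_π ≠ 0` and `S_π + W Wᵀ ⪰ 0` for one
column `W`, and every other letter is PSD, then at every positive root `u` of `det F` the matrix `F(u) = ∑ u^{dₗ} Sₗ` is PSD
(tree `Pivot.IndexOneRoots.posSemidef_of_det_eq_zero` applied to `A = ∑_{l ≠ π} u^{dₗ} Sₗ ⪰ 0`, `λ = u^{d_π}`). [folklore] -/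
theorem posSemidef_at_posRoot_general (d : Fin K → ℕ) (S : Fin K → Matrix (Fin m) (Fin m) ℝ) (π : Fin K)
    (hJ : (S π).IsSymm) (hJdet : (S π).det ≠ 0) (W : Matrix (Fin m) (Fin 1) ℝ) (hW : (S π + W * Wᵀ).PosSemidef)
    (hsign : ∀ l, l ≠ π → (S l).PosSemidef) {u : ℝ} (hu : 0 < u)
    (hroot : u ∈ (Matrix.det (∑ l, ((X : ℝ[X]) ^ d l) • (S l).map Polynomial.C)).roots) :
    (∑ l, (u ^ d l) • S l).PosSemidef := by
  classical
  have hdet : (∑ l, (u ^ d l) • S l).det = 0 := by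
    have h := (Polynomial.mem_roots'.1 hroot).2
    rwa [Polynomial.IsRoot.def, ChainSector.eval_det_pencil] at h
  have hsplit : ∑ l, (u ^ d l) • S l = (∑ l ∈ Finset.univ.erase π, (u ^ d l) • S l) + u ^ d π • S π := by
    rw [add_comm]
    exact (Finset.add_sum_erase Finset.univ (fun l => (u ^ d l) • S l) (Finset.mem_univ π)).symm
  have hA : (∑ l ∈ Finset.univ.erase π, (u ^ d l) • S l).PosSemidef := by
    refine Matrix.posSemidef_sum _ fun l hl => ?_
    exact (hsign l (Finset.ne_of_mem_erase hl)).smul (pow_nonneg hu.le _)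
  rw [hsplit] at hdet ⊢
  exact Pivot.IndexOneRoots.posSemidef_of_det_eq_zero hA hJ hJdet W hW (pow_pos hu _) hdet

/-! ### 4. The pivot-valley law at index one -/

/-- **PIVOT-VALLEY LAW AT INDEX ONE**: `Z₊ ≤ 2 + #{roots in the valley [x₁, x₂)}`.  Pivot letter of negative index one
(`det S_π ≠ 0`, `S_π + W Wᵀ ⪰ 0`), all other letters PSD, dominance certificates of `…PivotValley` at `0 < x₁ ≤ x₂`: the left flank
`(0, x₁)` and the right flank `[x₂, ∞)` carry at most ONE root each (every size `m`). [folklore] -/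
theorem pivotValley_posRoots_le_two_add_of_indexOne (d : Fin K → ℕ) (S : Fin K → Matrix (Fin m) (Fin m) ℝ)
    (hS : ∀ l, (S l).IsSymm) (π : Fin K) (hsign : ∀ l, l ≠ π → (S l).PosSemidef)
    (hJdet : (S π).det ≠ 0) (W : Matrix (Fin m) (Fin 1) ℝ) (hW : (S π + W * Wᵀ).PosSemidef)
    (x₁ x₂ : ℝ) (hx₁ : 0 < x₁) (hx₁₂ : x₁ ≤ x₂)
    (hdom₁ : (∑ l ∈ univ.filter (fun l => d l < d π), (((d π - d l : ℕ) : ℝ) * x₁ ^ d l) • S l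
      - ∑ l ∈ univ.filter (fun l => d π < d l), (((d l - d π : ℕ) : ℝ) * x₁ ^ d l) • S l).PosSemidef)
    (hdom₂ : (∑ l ∈ univ.filter (fun l => d π < d l), (((d l - d π : ℕ) : ℝ) * x₂ ^ d l) • S l
      - ∑ l ∈ univ.filter (fun l => d l < d π), (((d π - d l : ℕ) : ℝ) * x₂ ^ d l) • S l).PosSemidef) :
    ((Matrix.det (∑ l, ((Polynomial.X : Polynomial ℝ) ^ d l) • (S l).map Polynomial.C)
        ).roots.toFinset.filter (fun t => 0 < t)).card
      ≤ 2 + ((Matrix.det (∑ l, ((Polynomial.X : Polynomial ℝ) ^ d l) • (S l).map Polynomial.C)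
        ).roots.toFinset.filter (fun t => x₁ ≤ t ∧ t < x₂)).card := by
  classical
  set P := Matrix.det (∑ l, ((Polynomial.X : Polynomial ℝ) ^ d l) • (S l).map Polynomial.C) with hP
  have hsign' : ∀ l, d l ≠ d π → (S l).PosSemidef := fun l hl => hsign l fun h => hl (by rw [h])
  have hpsd : ∀ u, 0 < u → u ∈ P.roots → (∑ l, (u ^ d l) • S l).PosSemidef :=
    fun u hu hr => posSemidef_at_posRoot_general d S π (hS π) hJdet W hW hsign hu hr
  have h1 : (P.roots.toFinset.filter (fun t => t ∈ Set.Ioo 0 x₁)).card ≤ 1 :=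
    card_roots_window_le_one_anti d S hS π (Set.Ioo 0 x₁) Set.ordConnected_Ioo (fun u hu => hu.1)
      (fun u hu hr => hpsd u hu.1 hr)
      (fun s hs t ht hst => flank_anti_left d S hS π hsign' x₁ hx₁ hdom₁ s t hs.1 hst ht.2.le)
  have h2 : (P.roots.toFinset.filter (fun t => t ∈ Set.Ici x₂)).card ≤ 1 :=
    card_roots_window_le_one_mono d S hS π (Set.Ici x₂) Set.ordConnected_Ici
      (fun u hu => (hx₁.trans_le hx₁₂).trans_le hu)
      (fun u hu hr => hpsd u ((hx₁.trans_le hx₁₂).trans_le hu) hr)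
      (fun s hs t _ hst => flank_mono_right d S hS π hsign' x₂ (hx₁.trans_le hx₁₂) hdom₂ s t hs hst)
  have hsub : P.roots.toFinset.filter (fun t => 0 < t)
      ⊆ (P.roots.toFinset.filter (fun t => t ∈ Set.Ioo 0 x₁) ∪ P.roots.toFinset.filter (fun t => t ∈ Set.Ici x₂))
        ∪ P.roots.toFinset.filter (fun t => x₁ ≤ t ∧ t < x₂) := by
    intro t ht
    rw [Finset.mem_filter] at ht
    simp only [Finset.mem_union, Finset.mem_filter, Set.mem_Ioo, Set.mem_Ici]
    by_cases htx₁ : t < x₁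
    · exact Or.inl (Or.inl ⟨ht.1, ht.2, htx₁⟩)
    · by_cases htx₂ : x₂ ≤ t
      · exact Or.inl (Or.inr ⟨ht.1, htx₂⟩)
      · push Not at htx₁ htx₂
        exact Or.inr ⟨ht.1, htx₁, htx₂⟩
  calc (P.roots.toFinset.filter (fun t => 0 < t)).card
      ≤ ((P.roots.toFinset.filter (fun t => t ∈ Set.Ioo 0 x₁) ∪ P.roots.toFinset.filter (fun t => t ∈ Set.Ici x₂))
          ∪ P.roots.toFinset.filter (fun t => x₁ ≤ t ∧ t < x₂)).card := Finset.card_le_card hsub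
    _ ≤ ((P.roots.toFinset.filter (fun t => t ∈ Set.Ioo 0 x₁) ∪ P.roots.toFinset.filter (fun t => t ∈ Set.Ici x₂))).card
          + (P.roots.toFinset.filter (fun t => x₁ ≤ t ∧ t < x₂)).card := Finset.card_union_le _ _
    _ ≤ ((P.roots.toFinset.filter (fun t => t ∈ Set.Ioo 0 x₁)).card
          + (P.roots.toFinset.filter (fun t => t ∈ Set.Ici x₂)).card)
          + (P.roots.toFinset.filter (fun t => x₁ ≤ t ∧ t < x₂)).card :=
        Nat.add_le_add_right (Finset.card_union_le _ _) _
    _ ≤ (1 + 1) + (P.roots.toFinset.filter (fun t => x₁ ≤ t ∧ t < x₂)).card :=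
        Nat.add_le_add_right (Nat.add_le_add h1 h2) _
    _ = 2 + (P.roots.toFinset.filter (fun t => x₁ ≤ t ∧ t < x₂)).card := by norm_num

/-- **PIVOT-VALLEY LAW AT INDEX ONE, root-free valley**: `Z₊ ≤ 2` (every size `m`; the valley law `…PivotValley` gives `2m`).
[folklore] -/
theorem pivotValley_posRoots_le_two_of_indexOne (d : Fin K → ℕ) (S : Fin K → Matrix (Fin m) (Fin m) ℝ)
    (hS : ∀ l, (S l).IsSymm) (π : Fin K) (hsign : ∀ l, l ≠ π → (S l).PosSemidef)
    (hJdet : (S π).det ≠ 0) (W : Matrix (Fin m) (Fin 1) ℝ) (hW : (S π + W * Wᵀ).PosSemidef)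
    (x₁ x₂ : ℝ) (hx₁ : 0 < x₁) (hx₁₂ : x₁ ≤ x₂)
    (hdom₁ : (∑ l ∈ univ.filter (fun l => d l < d π), (((d π - d l : ℕ) : ℝ) * x₁ ^ d l) • S l
      - ∑ l ∈ univ.filter (fun l => d π < d l), (((d l - d π : ℕ) : ℝ) * x₁ ^ d l) • S l).PosSemidef)
    (hdom₂ : (∑ l ∈ univ.filter (fun l => d π < d l), (((d l - d π : ℕ) : ℝ) * x₂ ^ d l) • S l
      - ∑ l ∈ univ.filter (fun l => d l < d π), (((d π - d l : ℕ) : ℝ) * x₂ ^ d l) • S l).PosSemidef)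
    (hmid : ∀ x, x₁ ≤ x → x < x₂ →
      (Matrix.det (∑ l, ((Polynomial.X : Polynomial ℝ) ^ d l) • (S l).map Polynomial.C)).eval x ≠ 0) :
    ((Matrix.det (∑ l, ((Polynomial.X : Polynomial ℝ) ^ d l) • (S l).map Polynomial.C)
        ).roots.toFinset.filter (fun t => 0 < t)).card ≤ 2 := by
  classical
  have h := pivotValley_posRoots_le_two_add_of_indexOne d S hS π hsign hJdet W hW x₁ x₂ hx₁ hx₁₂ hdom₁ hdom₂
  have h0 : ((Matrix.det (∑ l, ((Polynomial.X : Polynomial ℝ) ^ d l) • (S l).map Polynomial.C)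
        ).roots.toFinset.filter (fun t => x₁ ≤ t ∧ t < x₂)).card = 0 := by
    refine Finset.card_eq_zero.2 (Finset.filter_eq_empty_iff.2 fun t ht hx => ?_)
    have hmem := Multiset.mem_toFinset.1 ht
    exact hmid t hx.1 hx.2 ((Polynomial.mem_roots (Polynomial.ne_zero_of_mem_roots hmem)).1 hmem)
  omega

end Summit.ValiantsHypothesis.ValiantsHypothesis.Theorems.LacunarySymmetroidMatrixDescartes.PivotValleyIndexOne
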